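import Literature.Analysis.Asymptotics.GaussianDamping
import Mathlib.Analysis.Calculus.Taylor
import Mathlib.Analysis.Convex.Basic
import HarnessLib

/-!
# First-order STRONG CONVEXITY from a lower Hessian bound along segments — the `hsc` hypothesis of the parametric minimiser
# (free-hands support of ⟨stmt-QuantumFields-24197⟩ `SwapVirialDeficit.SwapGluedStiffness`; generic, companion of
# ✓`SwapVirialDeficitQuantitativeLaplaceFibreMinimiser`)

✓`exists_minimiser_of_strongConvex` ∕ ✓`continuous_fibreMinimiser` (this seat, p827453) take strong convexity in the first-order form
`hsc : F x₀ + DF(x₀)[x − x₀] + (λ/2)‖x − x₀‖² ≤ F x` for `x₀, x` in a closed ball.  The model side delivers instead a `C²` fibre phase with a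
LOWER BOUND ON THE HESSIAN FORM on the ball, `λ‖v‖² ≤ D²F(z)[v, v]` (from quadratic growth at flat points, w3 g65's ✓`inner_ge_of_growth_of_taylor`, made
uniform on a `1/poly(L)` ball by the Hessian-Lipschitz jets of fcl-p3 g47).  This file is the bridge:
* ★★ `strongConvex_of_hessian_lower` — `F ∈ C²(V)`, `λ‖v‖² ≤ D²F(z)[v,v]` for all `z` in the closed ball `B̄(c, ρ)` and all `v` ⟹ `hsc` on `B̄(c, ρ)`
  (Taylor–Lagrange of order one on the segment, Mathlib `taylor_mean_remainder_lagrange`, through the tree's ray lemma ✓`GaussianBeam.iteratedDeriv_comp_smul`);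
* ★ `strongConvex_family_of_hessian_lower` — the fibred form, producing the `hsc` hypothesis of ✓`continuous_fibreMinimiser` verbatim for `F : M × V → ℝ`.

HONEST FRAMING: elementary calculus; width 0 by itself toward any lattice statement; ⟨24197⟩, ⟨24196⟩, ⟨24194⟩, ⟨24497⟩ and every rung ∕ summit statement stay
OPEN; own crux ⟨22884⟩ OPEN (blocked-on ⟨19935⟩); the Yang–Mills mass gap is NOT proved; no summit is proved by a line.  Width seat ym-line-sfw-p2-w2 g58
(cell ym-idea-1, free hands), `--supports stmt-QuantumFields-24197`.  THEOREMS ONLY (0 `def`, 0 `sorry`), standard axioms.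

## References
* Yu. Nesterov, *Introductory Lectures on Convex Optimization*, Kluwer (2004), Thm 2.1.11 (second-order characterisation of strong convexity). [folklore]
-/

set_option autoImplicit false

noncomputable section

open _root_.Set _root_.Metric
open scoped _root_.Topology

namespace Summit.QuantumFields.YangMills.Theorems.QuantitativeLaplace

open Literature.Analysis.Asymptotics.GaussianBeam (iteratedDeriv_comp_smul)

variable {V : Type*} [NormedAddCommGroup V] [InnerProductSpace ℝ V]

/-- ★★ **Strong convexity (first-order form) from a lower Hessian bound on a ball.**  If `F : V → ℝ` is `C²` and
`λ‖v‖² ≤ D²F(z)[v,v]` for every `z ∈ B̄(c, ρ)` and every `v`, then for all `x₀, x ∈ B̄(c, ρ)`: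
`F x₀ + DF(x₀)[x − x₀] + (λ/2)‖x − x₀‖² ≤ F x`.  (Taylor–Lagrange of order `1` on the segment `[x₀, x] ⊆ B̄(c,ρ)`.) [folklore] -/
theorem strongConvex_of_hessian_lower {F : V → ℝ} (hF : ContDiff ℝ 2 F) {lam ρ : ℝ} {c : V}
    (hH : ∀ z ∈ closedBall c ρ, ∀ v : V, lam * ‖v‖ ^ 2 ≤ iteratedFDeriv ℝ 2 F z (fun _ => v)) :
    ∀ x₀ ∈ closedBall c ρ, ∀ x ∈ closedBall c ρ,
      F x₀ + fderiv ℝ F x₀ (x - x₀) + lam / 2 * ‖x - x₀‖ ^ 2 ≤ F x := by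
  intro x₀ hx₀ x hx
  set v : V := x - x₀ with hv
  -- the function along the segment, as a ray of the translate `G z = F (z + x₀)`
  set G : V → ℝ := fun z => F (z + x₀) with hG
  have hGdiff : ContDiff ℝ 2 G := hF.comp (contDiff_id.add contDiff_const)
  set g : ℝ → ℝ := fun t => G (t • v) with hg
  have hg_eq : ∀ t, g t = F (x₀ + t • v) := fun t => by simp only [hg, hG, add_comm]
  have hgdiff : ContDiff ℝ 2 g := by
    simp only [hg]; exact hGdiff.comp (contDiff_id.smul contDiff_const)
  have hgder : ∀ n ≤ 2, ∀ t, iteratedDeriv n g t = iteratedFDeriv ℝ n F (x₀ + t • v) fun _ => v := by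
    intro n hn t
    have h1 : iteratedDeriv n g t = iteratedFDeriv ℝ n G (t • v) fun _ => v :=
      iteratedDeriv_comp_smul hGdiff v (by exact_mod_cast hn) t
    rw [h1, hG, iteratedFDeriv_comp_add_right, add_comm]
  -- Taylor–Lagrange of order 1 on `[0, 1]`
  have h01 : (0 : ℝ) ≠ 1 := zero_ne_one
  have hIcc : uIcc (0 : ℝ) 1 = Icc 0 1 := uIcc_of_le zero_le_one
  have hIoo : uIoo (0 : ℝ) 1 = Ioo 0 1 := uIoo_of_le zero_le_one
  have hwithin : ∀ n ≤ 2, ∀ t ∈ Icc (0 : ℝ) 1, iteratedDerivWithin n g (Icc 0 1) t = iteratedDeriv n g t :=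
    fun n hn t ht => iteratedDerivWithin_eq_iteratedDeriv (uniqueDiffOn_Icc zero_lt_one)
      (hgdiff.contDiffAt.of_le (by exact_mod_cast hn)) ht
  have hf : ContDiffOn ℝ 1 g (uIcc (0 : ℝ) 1) := (hgdiff.of_le (by norm_num)).contDiffOn
  have hf' : DifferentiableOn ℝ (iteratedDerivWithin 1 g (uIcc (0 : ℝ) 1)) (uIoo (0 : ℝ) 1) := by
    rw [hIcc, hIoo]
    have hd : Differentiable ℝ (iteratedDeriv 1 g) :=
      hgdiff.differentiable_iteratedDeriv 1 (by exact_mod_cast (show (1 : ℕ) < 2 by norm_num))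
    refine (hd.differentiableOn (s := Ioo (0 : ℝ) 1)).congr fun t ht => ?_
    exact hwithin 1 (by norm_num) t (Ioo_subset_Icc_self ht)
  obtain ⟨ξ, hξ, hlag⟩ := taylor_mean_remainder_lagrange (f := g) (n := 1) h01 hf hf'
  rw [hIoo] at hξ
  rw [hIcc] at hlag
  -- identify the pieces
  have hξI : ξ ∈ Icc (0 : ℝ) 1 := Ioo_subset_Icc_self hξ
  have hpoly : taylorWithinEval g 1 (Icc 0 1) 0 1 = F x₀ + fderiv ℝ F x₀ v := by
    rw [taylor_within_apply]
    simp only [Finset.sum_range_succ, Finset.sum_range_zero, zero_add, sub_zero, smul_eq_mul, one_pow,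
      Nat.factorial_zero, Nat.factorial_one, Nat.cast_one, inv_one, one_mul, mul_one]
    rw [iteratedDerivWithin_zero, hwithin 1 (by norm_num) 0 (left_mem_Icc.mpr zero_le_one), hgder 1 (by norm_num) 0,
      iteratedFDeriv_one_apply]
    simp only [hg, hG, zero_smul, zero_add, add_zero]
  have h2 : iteratedDerivWithin 2 g (Icc 0 1) ξ = iteratedFDeriv ℝ 2 F (x₀ + ξ • v) fun _ => v := by
    rw [hwithin 2 le_rfl ξ hξI, hgder 2 le_rfl ξ]
  have hmem : x₀ + ξ • v ∈ closedBall c ρ := by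
    rw [hv]
    exact (convex_closedBall c ρ).add_smul_sub_mem hx₀ hx hξI
  have hlow := hH _ hmem v
  have hg1 : g 1 = F x := by rw [hg_eq]; simp [hv]
  rw [hpoly, h2, hg1] at hlag
  -- `F x − (F x₀ + DF x₀ v) = D²F(…)[v,v]·1²/2! ≥ (λ/2)‖v‖²`
  have hval : F x - (F x₀ + fderiv ℝ F x₀ v) = (iteratedFDeriv ℝ 2 F (x₀ + ξ • v) fun _ => v) / 2 := by
    rw [hlag]; norm_num [Nat.factorial]
  have : lam / 2 * ‖v‖ ^ 2 ≤ F x - (F x₀ + fderiv ℝ F x₀ v) := by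
    rw [hval]; linarith
  linarith

/-- ★ **Fibred form**: for `F : M × V → ℝ` with every fibre `y ↦ F(p,y)` of class `C²` and `λ‖v‖² ≤ D²F_p(z)[v,v]` on `B̄(0,ρ)`, the `hsc` hypothesis of
✓`exists_fibreMinimiser` ∕ ✓`continuous_fibreMinimiser` holds on every fibre. [folklore] -/
theorem strongConvex_family_of_hessian_lower {M : Type*} {F : M × V → ℝ} (hF : ∀ p, ContDiff ℝ 2 fun y => F (p, y))
    {lam ρ : ℝ}
    (hH : ∀ p, ∀ z ∈ closedBall (0 : V) ρ, ∀ v : V, lam * ‖v‖ ^ 2 ≤ iteratedFDeriv ℝ 2 (fun y => F (p, y)) z (fun _ => v)) :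
    ∀ p, ∀ x₀ ∈ closedBall (0 : V) ρ, ∀ x ∈ closedBall (0 : V) ρ,
      F (p, x₀) + fderiv ℝ (fun y => F (p, y)) x₀ (x - x₀) + lam / 2 * ‖x - x₀‖ ^ 2 ≤ F (p, x) :=
  fun p => strongConvex_of_hessian_lower (hF p) (hH p)

end Summit.QuantumFields.YangMills.Theorems.QuantitativeLaplace

end
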